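import Summits.HodgeConjecture.HodgeCM.Model.AdelicThetaDistributionSat_1

/-! PORT of `HodgeCM/Model/AdelicThetaDistributionSat.lean` (HodgeCMPerL run 82) — part 2: continuation of `Summits.HodgeConjecture.HodgeCM.Model.AdelicThetaDistributionSat_1` (split at a top-level declaration boundary by port_pkg.py; scope re-opened below; declarations unchanged). -/

-- port_pkg: scope re-opened for this part (file-level context, then the namespace/section stack open at the cut)
set_option autoImplicit false
noncomputable section
open MeasureTheory MulAction IsDedekindDomain NumberField.mixedEmbedding Filter Topology
open NumberField hiding relNormOneIdeles relNormOneRat probHaarRelNormOneQuot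
open Literature.NumberTheory.Automorphic Literature.NumberTheory.Weil1964
open Literature.NumberTheory.Automorphic.UnitaryGroup
open Literature.NumberTheory.Automorphic.WeightForms (IsLevelCorrected IsWeightMatched)
open Literature.Geometry.ComplexHyperbolic.BallModel (U21 x₀)
open Literature.AlgebraicGeometry.HodgeTheory Literature.AlgebraicGeometry.ShimuraVarieties
open Literature.NumberTheory.Automorphic.PicardCM
open HodgeCM.Model.SupplyInstance HodgeCM.Model.SupplyResidual HodgeCM.Model.ThetaSpace HodgeCM.Model.TowerCarrier
open HodgeCM.Model.SupplyResidual.WeilPairData (charInv)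
open scoped SchwartzMap TensorProduct Classical
namespace HodgeCM
namespace Model
namespace ThetaAdelicSide
namespace ThetaDistDatum
variable {L : CMField} {ι₁ : L →+* ℂ} {V : HermSpace3 L ι₁} {c : SeesawCtx L}
variable {S : ThetaAdelicSide V c} {hV : IsAnisotropic L V.Hm} {k : Fin 4} (D : S.ThetaDistDatum hV k)
section HolSatU
variable (hGfin : ∀ K : Subgroup ↥V.adelicFin, satG hV K ≤ S.Gfin) (hLF : (S.P k).IsLFAction)
  (hd : ∀ (T : 𝓢((Fin 3 → mixedSpace (↥(maximalRealSubfield L))), ℂ) →L[ℂ] ℂ) (ℓ : Module.Dual ℂ (Fin 2 → ℂ)),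
    DifferentiableAt ℝ (fun b => T (D.ωA (BallForms.expP b) (D.Φarch ℓ))) 0)
  (hCR : ∀ (T : 𝓢((Fin 3 → mixedSpace (↥(maximalRealSubfield L))), ℂ) →L[ℂ] ℂ) (ℓ : Module.Dual ℂ (Fin 2 → ℂ)) (v : Fin 2 → ℂ),
    fderiv ℝ (fun b => T (D.ωA (BallForms.expP b) (D.Φarch ℓ))) 0 (Complex.I • v) =
      Complex.I • fderiv ℝ (fun b => T (D.ωA (BallForms.expP b) (D.Φarch ℓ))) 0 v)
  {𝓕 : Set C(↥(relNormOneIdeles (↥(maximalRealSubfield L)) L) ⧸ relNormOneRat (↥(maximalRealSubfield L)) L, ℂ)}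
  {f : C(↥(relNormOneIdeles (↥(maximalRealSubfield L)) L) ⧸ relNormOneRat (↥(maximalRealSubfield L)) L, ℂ)}
include hGfin hLF hd hCR in
/-- **`dist f Φ_f ∈ holSatU`** for EVERY finite test function. -/
theorem dist_mem_holSatU (hf : f ∈ 𝓕) (Φf : FinSB (↥(maximalRealSubfield L)) (Fin 3)) : D.dist f Φf ∈ S.holSatU hV k 𝓕 := by
  obtain ⟨i, hi⟩ := D.exists_tlvl_fix Φf
  exact S.holSat_le_holSatU hV k i (D.dist_mem_holSat hGfin hLF hd hCR i.1 hi hf)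

/-- **The theta distribution of the slot against `f ∈ 𝓕`, INTO the saturated hol-germ theta module `holSatU`** (`ℂ`-linear). -/
def distU (hf : f ∈ 𝓕) : FinSB (↥(maximalRealSubfield L)) (Fin 3) →ₗ[ℂ] S.holSatU hV k 𝓕 :=
  (D.dist f).codRestrict (S.holSatU hV k 𝓕) (D.dist_mem_holSatU hGfin hLF hd hCR hf)

/-- (Ported verbatim from the HodgeCMPerL package; no docstring in the source.) -/
@[simp] theorem coe_distU (hf : f ∈ 𝓕) (Φf : FinSB (↥(maximalRealSubfield L)) (Fin 3)) :
    (D.distU hGfin hLF hd hCR hf Φf).1 = D.dist f Φf := rfl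

/-- **`hσ`**: `distU (ωf (k_f, 1) Φ_f) = holSatRep k_f (distU Φ_f)` — the distribution intertwines the finite factor on `U(V)(𝔸_f)` with
right translation (the hypothesis `hθ`/`hσ` of #1244 `clsU_mem_iSup_range_of_equivariant`). -/
theorem distU_ωf_V (hf : f ∈ 𝓕) (g : V.adelicFin) (Φf : FinSB (↥(maximalRealSubfield L)) (Fin 3)) :
    D.distU hGfin hLF hd hCR hf (D.ωf (g, 1) Φf) = S.holSatRep hV k 𝓕 g (D.distU hGfin hLF hd hCR hf Φf) := by
  apply Subtype.ext
  rw [coe_distU, coe_holSatRep_apply, coe_distU, D.dist_ωf_V]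

/-- **`hf`** (at `f = charInv χ ∈ 𝓕`): `distU (ωf (1, u) Φ_f) = chiFin χ u • distU Φ_f` — the `χ`-variance under the finite torus
(the hypothesis `hf` of theta-3's `TwistedCoinv.lift` / `WeilCoinv.weilCoinvLift`). -/
theorem distU_ωf_W (χ : PontryaginDual (↥(relNormOneIdeles (↥(maximalRealSubfield L)) L) ⧸ relNormOneRat (↥(maximalRealSubfield L)) L))
    (hχ : charInv χ ∈ 𝓕) (u : D.Uf) (Φf : FinSB (↥(maximalRealSubfield L)) (Fin 3)) :
    D.distU hGfin hLF hd hCR hχ (D.ωf (1, u) Φf) = ((D.chiFin χ u : ℂˣ) : ℂ) • D.distU hGfin hLF hd hCR hχ Φf := by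
  apply Subtype.ext
  rw [coe_distU, Submodule.coe_smul, coe_distU, D.dist_ωf_W]

end HolSatU

end ThetaDistDatum
end ThetaAdelicSide

end Model
end HodgeCM

end
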